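import Summits.QuantumFields.GaugeBoot.Rows.GLYZc2D3Red
import HarnessLib

/-!
# Gauge-boot: radix-encoding check of the reduction identity (kit for large isotypic reductions)

Cell `pub-gaugeboot` (HOME `run/shared/lean/pub/pub-gaugeboot/`), seat lean1 (binding layer; FANOUT-PLAN A126 (2), A148 (2),
A155 (2): kz-L2-H-3D rows C1–C2 and later Class-A families).

HONEST FRAMING (page 1 of every file of this cell): certified bounds on lattice expectations at STATED coupling,
gauge group, dimension and torus size; NOT a mass gap, NOT a continuum limit, NOT a string tension, NOT large `N`.
The venture is explicitly NOT Yang–Mills-summit-bearing (barriers `FixedCouplingUltralocality`,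
`PerturbativeInvisibility`).

The reduction step (`<Fam>RedCheck`, `<Fam>Red`) checks, entry by entry, that a problem file's reduced block entry
`e = ent k i j` (a sparse integer form `Σ c·y_v`) equals the expansion `colᵢᵀ·cls·colⱼ` of the raw class table
(`GLYZc2D3.SVec.expand`).  For the glyz families the kernel compared NORMALISED lists (`SVec.normExpand`, insertion sort per
slice); for the kz-L2-H-3D family (20 isotypic `H` blocks, columns of up to 96 raw lines, 3.0·10⁶ expansion terms) that is too
slow.  Here the two integer forms are compared through ONE big-integer identity: the radix-`2^s` positional encodings
`Σ_v coeff_v · 2^(s·v)` (split into positive and negative parts `encP`/`encN`, the expansion's computed slice by slice,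
`expEncP`/`expEncN`, so that the kernel's recursion depth stays `≤ |colᵢ| + |colⱼ|`) agree, and all coefficients are
`< 2^(s-1)` in absolute value (`absSum` bounds) — then the coefficient functions agree (`digits_inj`, balanced radix digits
are unique) and the two forms have the same value at every assignment: `eval_eq_of_encCheck`.  All arithmetic in the
kernel is on `Nat` literals (GMP-accelerated `+`, `*`, `<<<`, `^`).
-/

noncomputable section

open Literature.MathematicalPhysics.QuantumFieldTheory

namespace Summit.QuantumFields.GaugeBoot

namespace RedEnc

open GLYZc2D3

/-! ## The check -/

/-- `ℓ¹` mass of the coefficients of a sparse integer form. -/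
def absSum (l : SVec) : ℕ := (l.map fun p => p.2.natAbs).sum

/-- Positive part of the radix-`2^s` positional encoding: `Σ_{c>0} c·2^(s·v)`. -/
def encP (s : ℕ) (l : SVec) : ℕ := (l.map fun p => p.2.toNat <<< (s * p.1)).sum

/-- Negative part of the radix-`2^s` positional encoding: `Σ_{c<0} |c|·2^(s·v)`. -/
def encN (s : ℕ) (l : SVec) : ℕ := (l.map fun p => (-p.2).toNat <<< (s * p.1)).sum

/-- Positive part of the encoding of the expansion `colᵢᵀ·cls·colⱼ`, slice by slice (never materialising the expansion). -/
def expEncP (s : ℕ) (ci cj : SVec) (cls : ℕ → ℕ → ℕ) : ℕ :=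
  (ci.map fun p => (cj.map fun q => (p.2 * q.2).toNat <<< (s * cls p.1 q.1)).sum).sum

/-- Negative part of the encoding of the expansion. -/
def expEncN (s : ℕ) (ci cj : SVec) (cls : ℕ → ℕ → ℕ) : ℕ :=
  (ci.map fun p => (cj.map fun q => (-(p.2 * q.2)).toNat <<< (s * cls p.1 q.1)).sum).sum

/-- **The per-entry check**: keys of `e` below `n`, coefficient masses below `2^(s-1)`, and the radix-`2^s` encodings of
`e` and of the expansion `colᵢᵀ·cls·colⱼ` agree (`P_exp + N_e = P_e + N_exp` in `ℕ`). -/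
def encCheck (s n : ℕ) (ci cj : SVec) (cls : ℕ → ℕ → ℕ) (e : SVec) : Bool :=
  e.all (fun p => decide (p.1 < n)) && decide (2 * absSum e < 2 ^ s) && decide (2 * (absSum ci * absSum cj) < 2 ^ s) &&
    decide (expEncP s ci cj cls + encN s e = encP s e + expEncN s ci cj cls)

/-! ## The signed encoding and its digit expansion -/

/-- The signed value of the encoding: `Σ_{(v,c)} c·2^(s·v)`. -/
def encZ (s : ℕ) (l : SVec) : ℤ := (l.map fun p => p.2 * 2 ^ (s * p.1)).sum

/-- `encP − encN = encZ`. -/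
theorem encP_sub_encN (s : ℕ) : ∀ l : SVec, (encP s l : ℤ) - encN s l = encZ s l
  | [] => by simp [encP, encN, encZ]
  | p :: t => by
    have ih := encP_sub_encN s t
    simp only [encP, encN, encZ, List.map_cons, List.sum_cons, Nat.shiftLeft_eq] at ih ⊢
    push_cast at ih ⊢
    have hp : ((p.2.toNat : ℕ) : ℤ) - (((-p.2).toNat : ℕ) : ℤ) = p.2 := Int.toNat_sub_toNat_neg p.2
    linear_combination (2 : ℤ) ^ (s * p.1) * hp + ih

/-- The slice-wise positive encoding is the positive encoding of the expansion. -/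
theorem expEncP_eq (s : ℕ) (cj : SVec) (cls : ℕ → ℕ → ℕ) :
    ∀ ci : SVec, expEncP s ci cj cls = encP s (SVec.expand ci cj cls)
  | [] => by simp [expEncP, encP, SVec.expand]
  | p :: t => by
    have ih := expEncP_eq s cj cls t
    have lhs : expEncP s (p :: t) cj cls =
        (cj.map fun q => (p.2 * q.2).toNat <<< (s * cls p.1 q.1)).sum + expEncP s t cj cls := by
      simp [expEncP]
    have rhs : encP s (SVec.expand (p :: t) cj cls) =
        encP s (cj.map fun q => (cls p.1 q.1, p.2 * q.2)) + encP s (SVec.expand t cj cls) := by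
      simp [encP, SVec.expand, List.flatMap_cons, List.map_append, List.sum_append]
    rw [lhs, rhs, ih]
    congr 1
    simp [encP, List.map_map, Function.comp_def]

/-- The slice-wise negative encoding is the negative encoding of the expansion. -/
theorem expEncN_eq (s : ℕ) (cj : SVec) (cls : ℕ → ℕ → ℕ) :
    ∀ ci : SVec, expEncN s ci cj cls = encN s (SVec.expand ci cj cls)
  | [] => by simp [expEncN, encN, SVec.expand]
  | p :: t => by
    have ih := expEncN_eq s cj cls t
    have lhs : expEncN s (p :: t) cj cls =
        (cj.map fun q => (-(p.2 * q.2)).toNat <<< (s * cls p.1 q.1)).sum + expEncN s t cj cls := by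
      simp [expEncN]
    have rhs : encN s (SVec.expand (p :: t) cj cls) =
        encN s (cj.map fun q => (cls p.1 q.1, p.2 * q.2)) + encN s (SVec.expand t cj cls) := by
      simp [encN, SVec.expand, List.flatMap_cons, List.map_append, List.sum_append]
    rw [lhs, rhs, ih]
    congr 1
    simp [encN, List.map_map, Function.comp_def]

/-- The keys of an expansion are values of the class table. -/
theorem expand_keys_lt {n : ℕ} (ci cj : SVec) (cls : ℕ → ℕ → ℕ) (hcls : ∀ a b, cls a b < n) :
    ∀ p ∈ SVec.expand ci cj cls, p.1 < n := by
  intro p hp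
  simp only [SVec.expand, List.mem_flatMap, List.mem_map] at hp
  obtain ⟨a, _, b, _, rfl⟩ := hp
  exact hcls _ _

/-- **The signed encoding is the digit expansion of the coefficient function** (keys `< n`). -/
theorem encZ_eq_sum_coeff (s : ℕ) {n : ℕ} : ∀ l : SVec, (∀ p ∈ l, p.1 < n) →
    encZ s l = ∑ v ∈ Finset.range n, SVec.coeff l v * 2 ^ (s * v)
  | [], _ => by simp [encZ, SVec.coeff]
  | (w, c) :: t, h => by
    have hw : w < n := h (w, c) List.mem_cons_self
    have ih := encZ_eq_sum_coeff s t fun q hq => h q (List.mem_cons_of_mem _ hq)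
    simp only [encZ, List.map_cons, List.sum_cons] at ih ⊢
    rw [ih]
    simp only [SVec.coeff, add_mul, ite_mul, zero_mul, Finset.sum_add_distrib, Finset.sum_ite_eq,
      Finset.mem_range, hw, if_true]

/-! ## Coefficient bounds -/

/-- `|coeff l v| ≤ absSum l`. -/
theorem abs_coeff_le_absSum (v : ℕ) : ∀ l : SVec, |SVec.coeff l v| ≤ absSum l
  | [] => by simp [SVec.coeff, absSum]
  | (w, c) :: t => by
    have ih := abs_coeff_le_absSum v t
    simp only [SVec.coeff, absSum, List.map_cons, List.sum_cons] at ih ⊢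
    rw [Nat.cast_add]
    refine (abs_add_le _ _).trans (add_le_add ?_ ih)
    split_ifs
    · rw [Int.natCast_natAbs]
    · simp

/-- `coeff` is additive over appends. -/
theorem coeff_append (v : ℕ) : ∀ l₁ l₂ : SVec, SVec.coeff (l₁ ++ l₂) v = SVec.coeff l₁ v + SVec.coeff l₂ v
  | [], l₂ => by simp [SVec.coeff]
  | (w, c) :: t, l₂ => by
    simp only [List.cons_append, SVec.coeff, coeff_append v t l₂]
    ring

/-- One slice: `|coeff (colⱼ relabelled and scaled by c) v| ≤ |c|·absSum colⱼ`. -/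
theorem abs_coeff_slice_le (v a : ℕ) (c : ℤ) (cls : ℕ → ℕ → ℕ) :
    ∀ cj : SVec, |SVec.coeff (cj.map fun q => (cls a q.1, c * q.2)) v| ≤ (c.natAbs : ℤ) * absSum cj
  | [] => by simp [SVec.coeff, absSum]
  | (w, d) :: t => by
    have ih := abs_coeff_slice_le v a c cls t
    simp only [List.map_cons, SVec.coeff, absSum, List.sum_cons] at ih ⊢
    rw [Nat.cast_add, mul_add]
    refine (abs_add_le _ _).trans (add_le_add ?_ ih)
    split_ifs
    · rw [abs_mul, Int.natCast_natAbs, Int.natCast_natAbs]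
    · rw [abs_zero]; positivity

/-- **`|coeff (colᵢᵀ·cls·colⱼ) v| ≤ absSum colᵢ · absSum colⱼ`.** -/
theorem abs_coeff_expand_le (v : ℕ) (cj : SVec) (cls : ℕ → ℕ → ℕ) :
    ∀ ci : SVec, |SVec.coeff (SVec.expand ci cj cls) v| ≤ (absSum ci : ℤ) * absSum cj
  | [] => by simp [SVec.coeff, SVec.expand, absSum]
  | (a, c) :: t => by
    have ih := abs_coeff_expand_le v cj cls t
    simp only [SVec.expand, List.flatMap_cons] at ih ⊢
    rw [coeff_append]
    simp only [absSum, List.map_cons, List.sum_cons]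
    rw [Nat.cast_add, add_mul]
    exact (abs_add_le _ _).trans (add_le_add (abs_coeff_slice_le v a c cls cj) ih)

/-! ## Balanced radix digits are unique -/

/-- **Uniqueness of balanced radix-`2^s` digits**: if two digit functions bounded by `M` with `2M < 2^s` have the same
positional value over `v < n`, they agree on `v < n`. -/
theorem digits_inj {s M n : ℕ} (hM : 2 * M < 2 ^ s) (c d : ℕ → ℤ) (hc : ∀ v, |c v| ≤ M) (hd : ∀ v, |d v| ≤ M)
    (h : ∑ v ∈ Finset.range n, c v * 2 ^ (s * v) = ∑ v ∈ Finset.range n, d v * 2 ^ (s * v)) :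
    ∀ v < n, c v = d v := by
  induction n with
  | zero => intro v hv; omega
  | succ n ih =>
    -- the difference of the lower digits is smaller than the top place value
    have hB : (1 : ℤ) ≤ 2 ^ s := one_le_pow₀ (by norm_num)
    have hδ : ∀ v, |c v - d v| ≤ 2 ^ s - 1 := fun v => by
      have := abs_sub (c v) (d v); have := hc v; have := hd v
      have hM' : (2 : ℤ) * M < 2 ^ s := by exact_mod_cast hM
      linarith
    have hgeom : ∀ m : ℕ, (∑ v ∈ Finset.range m, ((2 : ℤ) ^ s - 1) * 2 ^ (s * v)) = 2 ^ (s * m) - 1 := by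
      intro m
      induction m with
      | zero => simp
      | succ m ihm => rw [Finset.sum_range_succ, ihm]; ring_nf
    have hlow : |∑ v ∈ Finset.range n, (c v - d v) * 2 ^ (s * v)| ≤ 2 ^ (s * n) - 1 := by
      refine (Finset.abs_sum_le_sum_abs _ _).trans ?_
      rw [← hgeom n]
      refine Finset.sum_le_sum fun v _ => ?_
      rw [abs_mul, abs_of_nonneg (by positivity : (0 : ℤ) ≤ 2 ^ (s * v))]
      exact mul_le_mul_of_nonneg_right (hδ v) (by positivity)
    rw [Finset.sum_range_succ, Finset.sum_range_succ] at h
    have htop : (c n - d n) * 2 ^ (s * n) = -∑ v ∈ Finset.range n, (c v - d v) * 2 ^ (s * v) := by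
      simp only [sub_mul, Finset.sum_sub_distrib]; linarith
    have habs : |c n - d n| * 2 ^ (s * n) < 1 * 2 ^ (s * n) := by
      have := congrArg abs htop
      rw [abs_mul, abs_of_nonneg (by positivity : (0 : ℤ) ≤ 2 ^ (s * n)), abs_neg] at this
      rw [this]; linarith
    have hcn : c n = d n := by
      have : |c n - d n| < 1 := lt_of_mul_lt_mul_right habs (by positivity)
      have : |c n - d n| = 0 := by have := abs_nonneg (c n - d n); omega
      exact sub_eq_zero.mp (abs_eq_zero.mp this)
    have hrest : ∑ v ∈ Finset.range n, c v * 2 ^ (s * v) = ∑ v ∈ Finset.range n, d v * 2 ^ (s * v) := by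
      rw [hcn] at h; linarith
    intro v hv
    rcases Nat.lt_succ_iff_lt_or_eq.mp hv with hv | rfl
    · exact ih hrest v hv
    · exact hcn

/-! ## The check implies equality of the two forms at every assignment -/

/-- **Soundness of the radix check**: if `encCheck s n colᵢ colⱼ cls e` holds and the class table takes values `< n`, then
the file entry `e` and the expansion `colᵢᵀ·cls·colⱼ` have the same value at every assignment `g`. -/
theorem eval_eq_of_encCheck {s n : ℕ} {ci cj e : SVec} {cls : ℕ → ℕ → ℕ} (hcls : ∀ a b, cls a b < n)
    (h : encCheck s n ci cj cls e = true) (g : ℕ → ℝ) :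
    SVec.eval g e = SVec.eval g (SVec.expand ci cj cls) := by
  simp only [encCheck, Bool.and_eq_true, decide_eq_true_eq, List.all_eq_true] at h
  obtain ⟨⟨⟨hkeys, hme⟩, hmx⟩, hE⟩ := h
  have hkx := expand_keys_lt ci cj cls hcls
  -- the signed encodings agree
  have hZ : encZ s (SVec.expand ci cj cls) = encZ s e := by
    rw [← encP_sub_encN, ← encP_sub_encN, ← expEncP_eq, ← expEncN_eq]
    have := congrArg (fun x : ℕ => (x : ℤ)) hE
    push_cast at this
    linarith
  rw [encZ_eq_sum_coeff s _ hkx, encZ_eq_sum_coeff s _ hkeys] at hZ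
  -- digit bounds
  have hM : 2 * max (absSum ci * absSum cj) (absSum e) < 2 ^ s := by
    rcases le_total (absSum ci * absSum cj) (absSum e) with hle | hle
    · rw [max_eq_right hle]; exact hme
    · rw [max_eq_left hle]; exact hmx
  have hc : ∀ v, |SVec.coeff (SVec.expand ci cj cls) v| ≤ max (absSum ci * absSum cj) (absSum e) := fun v =>
    (abs_coeff_expand_le v cj cls ci).trans (by exact_mod_cast le_max_left _ _)
  have hd : ∀ v, |SVec.coeff e v| ≤ max (absSum ci * absSum cj) (absSum e) := fun v =>
    (abs_coeff_le_absSum v e).trans (by exact_mod_cast le_max_right _ _)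
  have hdig := digits_inj hM _ _ hc hd hZ
  rw [SVec.eval_eq_sum_fin e g hkeys, SVec.eval_eq_sum_fin _ g hkx]
  exact Finset.sum_congr rfl fun a _ => by rw [hdig a.val a.isLt]

/-- **Coefficient form of the radix check**: if `encCheck s n colᵢ colⱼ cls e` holds and the class table takes values `< n`,
the file entry `e` and the expansion `colᵢᵀ·cls·colⱼ` have the same coefficient at every variable `v < n` (the statement behind
`eval_eq_of_encCheck`; used when an identity is consumed entry-wise rather than through a valuation). -/
theorem coeff_eq_of_encCheck {s n : ℕ} {ci cj e : SVec} {cls : ℕ → ℕ → ℕ} (hcls : ∀ a b, cls a b < n)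
    (h : encCheck s n ci cj cls e = true) : ∀ v < n, SVec.coeff (SVec.expand ci cj cls) v = SVec.coeff e v := by
  simp only [encCheck, Bool.and_eq_true, decide_eq_true_eq, List.all_eq_true] at h
  obtain ⟨⟨⟨hkeys, hme⟩, hmx⟩, hE⟩ := h
  have hkx := expand_keys_lt ci cj cls hcls
  have hZ : encZ s (SVec.expand ci cj cls) = encZ s e := by
    rw [← encP_sub_encN, ← encP_sub_encN, ← expEncP_eq, ← expEncN_eq]
    have := congrArg (fun x : ℕ => (x : ℤ)) hE
    push_cast at this
    linarith
  rw [encZ_eq_sum_coeff s _ hkx, encZ_eq_sum_coeff s _ hkeys] at hZ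
  have hM : 2 * max (absSum ci * absSum cj) (absSum e) < 2 ^ s := by
    rcases le_total (absSum ci * absSum cj) (absSum e) with hle | hle
    · rw [max_eq_right hle]; exact hme
    · rw [max_eq_left hle]; exact hmx
  have hc : ∀ v, |SVec.coeff (SVec.expand ci cj cls) v| ≤ max (absSum ci * absSum cj) (absSum e) := fun v =>
    (abs_coeff_expand_le v cj cls ci).trans (by exact_mod_cast le_max_left _ _)
  have hd : ∀ v, |SVec.coeff e v| ≤ max (absSum ci * absSum cj) (absSum e) := fun v =>
    (abs_coeff_le_absSum v e).trans (by exact_mod_cast le_max_right _ _)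
  exact digits_inj hM _ _ hc hd hZ

end RedEnc

end Summit.QuantumFields.GaugeBoot

end
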